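import Mathlib
import Summits.ResolutionOfSingularities.ResolutionOfSingularities.Theorems.RadicialJungCleanModelsContactChainResidualLine
import Literature.AlgebraicGeometry.Resolution.RsopLocalization
import HarnessLib

/-!
# Route `RadicialJung`, crux `CleanModels` (stmt-ResolutionOfSingularities-15917), line `Sketch` rev 35, stub 6 `stub_cleanProp44` (X44c),
# work plan O8 / L7b — the clean type of the line at the GENERIC POINT of the curve: everything exits except the memo's (T2b) BAD PAIR

Memo `Cruxes/CleanModels/Lines/Sketch-memo-hand2-g8-stubs-5-7.md` §2 ((T1)/(T2) split by the clean type at `η_C`).  X44c's standing hypothesis is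
`CleanRegAt` at EVERY scheme point of the stage, in particular at the generic point `η_C` of the curve `C₀`, whose local ring is the localization
`B = (𝒪_{X₀,x₀})_P`, `P = 𝓘_{C₀,x₀}` (a regular local ring of dimension `2` with maximal ideal `PB`).  This file consumes that hypothesis at the
RING level — `B` any `IsLocalization.AtPrime B P` with a ring map `f : B → K(X₀)` extending `𝒪_{X₀,x₀} → K(X₀)` (for the scheme, `B = 𝒪_{X₀,η_C}` by
✓ `isLocalizationAtPrime_stalkSpecializes`) — and proves

* `exists_pointChain_cleanPermissibleAt_or_badPair_of_cleanRegAt_generic` — on a regular integral quasi-excellent `X₀` (`char K(X₀) = p`), at a closed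
  point `x₀` (`dim 𝒪_{X₀,x₀} = 3`) of a regular curve `C₀` with transversal parameter `w`: if the line of `G` is clean-regular at `B` (`CleanRegAt p f G`),
  then EITHER a dominant chain of point blowing ups following `C₀` reaches a clean-permissible landing, OR the line is in the memo's (T2b) BAD-PAIR
  configuration: an integral representative `v · q₀^{a₀} · q₁^{a₁}` with `v ∉ P`, `q₀, q₁ ∈ P ∖ P²`, `p ∤ a₀ a₁`, `(q₀, q₁)B = PB` (i.e. `e·P ⊆ (q₀, q₁)`
  for some `e ∉ P`) but `(q₀, q₁) ≠ P`.

Clearing denominators by `p`-th powers of elements off `P` (which rescales the coefficients `cc_j` of the representative): type (2) at `B` is (T1′)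
(✓ `exists_pointChain_cleanPermissibleAt_of_rep_residue_not_pow`); type (3) is a representative `R` with `R − b^p ∈ P ∖ P²`, i.e. (T2a′) after the shift
(✓ `rep_shift_sub_pow`, ✓ `exists_pointChain_cleanPermissibleAt_of_rep_mem_not_mem_sq`); type (1) has `m ≤ dim B = ht P = 2` factors
(✓ `IsRsopPart.height_span_range`): `m = 1` is (T2a) with exponent `a₀` (✓ `exists_simple_normalForm` + ✓ `cleanPermissibleAt_of_pointChain_simpleContaining`,
the cofactor `v = γ w^k + π` being ONE transversal component), `m = 2` with `(q₀, q₁) = P` is the containing-pair exit (✓ `exists_pointChain_cleanPermissibleAt`,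
charge `p ∤ a₀`), and `m = 2` with `(q₀, q₁) ≠ P` is the bad pair.

Honest framing: OURS; nothing here proves resolution in characteristic `p`, X44c, or any case of `CleanModels`.
-/

noncomputable section

set_option linter.dupNamespace false -- mandated namespace of this single-conjunct summit

open CategoryTheory AlgebraicGeometry TopologicalSpace IsLocalRing
open Literature.AlgebraicGeometry.Resolution Literature.AlgebraicGeometry.Motives
open Scheme.IdealSheafData

namespace Summit.ResolutionOfSingularities.ResolutionOfSingularities.Theorems.RadicialJung.CleanModels

/-- Rescaling a representative of the line by a `p`-th power: `(Σ cc_j^p G^j) · e^p = Σ (cc_j e)^p G^j`, and the non-triviality of the coefficients is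
kept when `e ≠ 0`. [folklore] -/
theorem rep_scale_mul_pow {F : Type*} [Field F] (p : ℕ) (G : F) (cc : Fin p → F) (hcc : ∃ j : Fin p, (j : ℕ) ≠ 0 ∧ cc j ≠ 0)
    (e X : F) (he : e ≠ 0) (hX : (∑ j : Fin p, cc j ^ p * G ^ (j : ℕ)) = X) :
    (∃ j : Fin p, (j : ℕ) ≠ 0 ∧ (fun j => cc j * e) j ≠ 0) ∧ (∑ j : Fin p, (fun j => cc j * e) j ^ p * G ^ (j : ℕ)) = e ^ p * X := by
  refine ⟨?_, ?_⟩
  · obtain ⟨j, hj, hj0⟩ := hcc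
    exact ⟨j, hj, mul_ne_zero hj0 he⟩
  · rw [← hX, Finset.mul_sum]
    exact Finset.sum_congr rfl fun j _ => by ring

/-- **The clean type at the generic point of the curve decides L7b, up to the bad pair.**  See the module docstring.
[cite: CossartJannsenSaito2020, proof of Thm. 6.28, Step 5] [cite: CossartPiltant2008, Prop. 4.4 (proof, p. 10)] [cite: Piltant2013, §2 Axiom 4]
[cite: Matsumura1987, Thm. 14.2] -/
theorem exists_pointChain_cleanPermissibleAt_or_badPair_of_cleanRegAt_generic {X₀ : Scheme.{0}} [IsIntegral X₀] [IsLocallyNoetherian X₀]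
    (hX₀ : Scheme.IsRegular X₀) (hE : Scheme.IsQuasiExcellent X₀) (p : ℕ) [hp : Fact p.Prime] [CharP X₀.functionField p] {C₀ : Closeds X₀}
    (hC₀reg : ∀ y ∈ (C₀ : Set X₀), ∃ c : Fin 2 → X₀.presheaf.stalk y,
      IsRsopPart c ∧ Ideal.span (Set.range c) = stalkIdeal (vanishingIdeal C₀) y)
    {x₀ : X₀} (hx₀ : IsClosed ({x₀} : Set X₀)) (hx₀C : x₀ ∈ (C₀ : Set X₀)) (hdim₀ : ringKrullDim (X₀.presheaf.stalk x₀) = 3)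
    [hP : (stalkIdeal (vanishingIdeal C₀) x₀).IsPrime]
    (w : X₀.presheaf.stalk x₀) (hw : stalkIdeal (vanishingIdeal C₀) x₀ ⊔ Ideal.span {w} = maximalIdeal _)
    (B : Type) [CommRing B] [Algebra (X₀.presheaf.stalk x₀) B] [IsLocalization.AtPrime B (stalkIdeal (vanishingIdeal C₀) x₀)]
    (f : B →+* X₀.functionField) (hf : ∀ a, f (algebraMap _ B a) = RatFn.toFunctionField x₀ a)
    (G : X₀.functionField) (hGη : CleanRegAt p f G) :
    (∃ (X : Scheme.{0}) (_ : IsIntegral X) (_ : IsLocallyNoetherian X) (σ : X ⟶ X₀) (_ : IsDominant σ) (C : Closeds X) (x : X)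
        (n : ℕ), IsPointChainAlong σ C₀ C x n ∧ σ x = x₀ ∧ IsClosed ({x} : Set X) ∧
        CleanPermissibleAt p (RatFn.toFunctionField x) (RatFn.functionFieldMap σ G) (stalkIdeal (vanishingIdeal C) x)) ∨
      ∃ (cc : Fin p → X₀.functionField) (v : X₀.presheaf.stalk x₀) (q : Fin 2 → X₀.presheaf.stalk x₀) (a : Fin 2 → ℕ)
        (e : X₀.presheaf.stalk x₀),
        (∃ j : Fin p, (j : ℕ) ≠ 0 ∧ cc j ≠ 0) ∧
        (∑ j : Fin p, cc j ^ p * G ^ (j : ℕ)) = RatFn.toFunctionField x₀ (v * ∏ i, q i ^ a i) ∧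
        v ∉ stalkIdeal (vanishingIdeal C₀) x₀ ∧ (∀ i, q i ∈ stalkIdeal (vanishingIdeal C₀) x₀) ∧
        (∀ i, q i ∉ stalkIdeal (vanishingIdeal C₀) x₀ ^ 2) ∧ (∀ i, ¬ p ∣ a i) ∧
        e ∉ stalkIdeal (vanishingIdeal C₀) x₀ ∧ Ideal.span {e} * stalkIdeal (vanishingIdeal C₀) x₀ ≤ Ideal.span (Set.range q) ∧
        Ideal.span (Set.range q) ≠ stalkIdeal (vanishingIdeal C₀) x₀ := by
  classical
  haveI : IsRegularLocalRing (X₀.presheaf.stalk x₀) := hX₀ x₀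
  obtain ⟨c2, hc2, hc2P⟩ := hC₀reg x₀ hx₀C
  -- the localization `B = A_P`
  haveI hBloc : IsLocalRing B := IsLocalization.AtPrime.isLocalRing B (stalkIdeal (vanishingIdeal C₀) x₀)
  have hmapP : Ideal.map (algebraMap (X₀.presheaf.stalk x₀) B) (stalkIdeal (vanishingIdeal C₀) x₀) = maximalIdeal B := IsLocalization.AtPrime.map_eq_maximalIdeal (stalkIdeal (vanishingIdeal C₀) x₀) B
  have hmemP : ∀ a : (X₀.presheaf.stalk x₀), (algebraMap (X₀.presheaf.stalk x₀) B) a ∈ maximalIdeal B ↔ a ∈ (stalkIdeal (vanishingIdeal C₀) x₀) := fun a => IsLocalization.AtPrime.to_map_mem_maximal_iff B (stalkIdeal (vanishingIdeal C₀) x₀) a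
  have hunitP : ∀ a : (X₀.presheaf.stalk x₀), IsUnit ((algebraMap (X₀.presheaf.stalk x₀) B) a) ↔ a ∉ (stalkIdeal (vanishingIdeal C₀) x₀) := fun a => IsLocalization.AtPrime.isUnit_to_map_iff B (stalkIdeal (vanishingIdeal C₀) x₀) a
  have hsurj : ∀ z : B, ∃ (a d : (X₀.presheaf.stalk x₀)), d ∉ (stalkIdeal (vanishingIdeal C₀) x₀) ∧ z * (algebraMap (X₀.presheaf.stalk x₀) B) d = (algebraMap (X₀.presheaf.stalk x₀) B) a := fun z => by
    obtain ⟨⟨a, d⟩, h⟩ := IsLocalization.surj (stalkIdeal (vanishingIdeal C₀) x₀).primeCompl z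
    exact ⟨a, d, d.2, h⟩
  have hinjf : Function.Injective (RatFn.toFunctionField x₀) := RatFn.toFunctionField_injective x₀
  have hne0 : ∀ d : (X₀.presheaf.stalk x₀), d ∉ (stalkIdeal (vanishingIdeal C₀) x₀) → RatFn.toFunctionField x₀ d ≠ 0 := fun d hd h0 =>
    hd (by rw [(injective_iff_map_eq_zero _).mp hinjf d h0]; exact (stalkIdeal (vanishingIdeal C₀) x₀).zero_mem)
  -- clearing one denominator by a `p`-th power: `(algebraMap (X₀.presheaf.stalk x₀) B)(d)^p · z = (algebraMap (X₀.presheaf.stalk x₀) B)(d^{p-1} a)` when `z (algebraMap (X₀.presheaf.stalk x₀) B)(d) = (algebraMap (X₀.presheaf.stalk x₀) B)(a)`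
  have hclear : ∀ (z : B) (a d : (X₀.presheaf.stalk x₀)), z * (algebraMap (X₀.presheaf.stalk x₀) B) d = (algebraMap (X₀.presheaf.stalk x₀) B) a → (algebraMap (X₀.presheaf.stalk x₀) B) d ^ p * z = (algebraMap (X₀.presheaf.stalk x₀) B) (d ^ (p - 1) * a) := by
    intro z a d h
    have hp1 : p = (p - 1) + 1 := (Nat.sub_add_cancel hp.out.one_le).symm
    rw [map_mul, map_pow, ← h]
    conv_lhs => rw [hp1, pow_succ]
    ring
  -- the shape of the exit, abbreviated
  obtain ⟨hregB, cc, hcc, hform⟩ := hGη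
  rcases hform with ⟨d, m, hmd, t, a, u, hu, hspan, hdim, hm, ha, hGX⟩ | ⟨u, hu, hGX, hup⟩ | ⟨s', c', hGX, hsc, hsc2⟩
  · -- ### type (1) at the generic point
    -- `dim B = ht (stalkIdeal (vanishingIdeal C₀) x₀) = 2`
    have hd2 : d = 2 := by
      have h1 : ringKrullDim B = (stalkIdeal (vanishingIdeal C₀) x₀).height := IsLocalization.AtPrime.ringKrullDim_eq_height (stalkIdeal (vanishingIdeal C₀) x₀) B
      have h2 : (stalkIdeal (vanishingIdeal C₀) x₀).height = 2 := by rw [← hc2P]; exact hc2.height_span_range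
      rw [hdim, h2] at h1
      exact_mod_cast h1
    subst hd2
    have hdB : (maximalIdeal B).spanFinrank = 2 := by
      have h := IsRegularLocalRing.spanFinrank_maximalIdeal (R := B)
      rw [hdim] at h
      exact_mod_cast h
    have htrsop : IsRsopPart (t ∘ Fin.castLE hmd) := isRsopPart_comp_of_rsop hdB t hspan (Fin.castLE hmd) (Fin.castLE_injective hmd)
    -- numerators and denominators of the used parameters and of the unit
    have hts : ∀ i : Fin m, ∃ q s : (X₀.presheaf.stalk x₀), s ∉ (stalkIdeal (vanishingIdeal C₀) x₀) ∧ t (Fin.castLE hmd i) * (algebraMap (X₀.presheaf.stalk x₀) B) s = (algebraMap (X₀.presheaf.stalk x₀) B) q := fun i => hsurj _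
    choose q s hs hqs using hts
    obtain ⟨v₀, s₀, hs₀, hus₀⟩ := hsurj u
    have hv₀ : v₀ ∉ (stalkIdeal (vanishingIdeal C₀) x₀) := by
      intro h
      have h1 : (algebraMap (X₀.presheaf.stalk x₀) B) v₀ ∈ maximalIdeal B := (hmemP v₀).mpr h
      rw [← hus₀] at h1
      exact (maximalIdeal.isMaximal B).ne_top (Ideal.eq_top_of_isUnit_mem _ h1 (hu.mul ((hunitP s₀).mpr hs₀)))
    have hqP : ∀ i, q i ∈ (stalkIdeal (vanishingIdeal C₀) x₀) := by
      intro i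
      rw [← hmemP, ← hqs i]
      refine Ideal.mul_mem_right _ _ ?_
      rw [← hspan]; exact Ideal.subset_span ⟨_, rfl⟩
    -- the integral representative `R = v · ∏ Q_i^{a_i}`
    set v : (X₀.presheaf.stalk x₀) := s₀ ^ (p - 1) * v₀ with hvdef
    set Q : Fin m → (X₀.presheaf.stalk x₀) := fun i => s i ^ (p - 1) * q i with hQdef
    have hvφ : (algebraMap (X₀.presheaf.stalk x₀) B) v = (algebraMap (X₀.presheaf.stalk x₀) B) s₀ ^ p * u := (hclear u v₀ s₀ hus₀).symm
    have hQφ : ∀ i, (algebraMap (X₀.presheaf.stalk x₀) B) (Q i) = (algebraMap (X₀.presheaf.stalk x₀) B) (s i) ^ p * t (Fin.castLE hmd i) := fun i => (hclear _ (q i) (s i) (hqs i)).symm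
    have hvP : v ∉ (stalkIdeal (vanishingIdeal C₀) x₀) := fun h => (hP.mem_or_mem h).elim (fun h1 => hs₀ (hP.mem_of_pow_mem _ h1)) hv₀
    have hQP : ∀ i, Q i ∈ (stalkIdeal (vanishingIdeal C₀) x₀) := fun i => Ideal.mul_mem_left _ _ (hqP i)
    have hQP2 : ∀ i, Q i ∉ (stalkIdeal (vanishingIdeal C₀) x₀) ^ 2 := by
      intro i hi
      have h1 : (algebraMap (X₀.presheaf.stalk x₀) B) (Q i) ∈ maximalIdeal B ^ 2 := by
        rw [← hmapP, ← Ideal.map_pow]; exact Ideal.mem_map_of_mem _ hi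
      rw [hQφ i] at h1
      obtain ⟨sU, hsU⟩ := (hunitP (s i)).mpr (hs i)
      have h2 : t (Fin.castLE hmd i) = (↑sU⁻¹ : B) ^ p * ((algebraMap (X₀.presheaf.stalk x₀) B) (s i) ^ p * t (Fin.castLE hmd i)) := by
        rw [← mul_assoc, ← mul_pow, ← hsU, Units.inv_mul, one_pow, one_mul]
      exact htrsop.not_mem_sq i (by rw [Function.comp_apply, h2]; exact Ideal.mul_mem_left _ _ h1)
    set D : (X₀.presheaf.stalk x₀) := s₀ * ∏ i, s i ^ a i with hDdef
    have hDP : D ∉ (stalkIdeal (vanishingIdeal C₀) x₀) := by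
      intro h
      rcases hP.mem_or_mem h with h1 | h1
      · exact hs₀ h1
      · obtain ⟨i, -, hi⟩ := Ideal.IsPrime.prod_mem_iff.mp h1
        exact hs i (hP.mem_of_pow_mem _ hi)
    have hRφ : (algebraMap (X₀.presheaf.stalk x₀) B) (v * ∏ i, Q i ^ a i) = (algebraMap (X₀.presheaf.stalk x₀) B) D ^ p * (u * ∏ i, t (Fin.castLE hmd i) ^ a i) := by
      rw [map_mul, hvφ, map_prod]
      have h1 : (∏ i, (algebraMap (X₀.presheaf.stalk x₀) B) (Q i ^ a i)) = (∏ i, (algebraMap (X₀.presheaf.stalk x₀) B) (s i) ^ a i) ^ p * ∏ i, t (Fin.castLE hmd i) ^ a i := by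
        rw [← Finset.prod_pow, ← Finset.prod_mul_distrib]
        refine Finset.prod_congr rfl fun i _ => ?_
        rw [map_pow, hQφ i, mul_pow, ← pow_mul, ← pow_mul, mul_comm p (a i)]
      rw [h1, hDdef, map_mul, map_prod]
      simp only [map_pow]
      ring
    -- the rescaled representative
    obtain ⟨hcc', hX'⟩ := rep_scale_mul_pow p G cc hcc (RatFn.toFunctionField x₀ D) _ (hne0 D hDP) hGX
    have hX : (∑ j : Fin p, (fun j => cc j * RatFn.toFunctionField x₀ D) j ^ p * G ^ (j : ℕ)) =
        RatFn.toFunctionField x₀ (v * ∏ i, Q i ^ a i) := by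
      rw [hX', ← hf, ← hf, ← map_pow, ← map_mul, ← hRφ]
    -- the cofactor `v` in contact normal form
    obtain ⟨k, γ, π, hγ, hπ, hvk⟩ := exists_contact_normalForm (stalkIdeal (vanishingIdeal C₀) x₀) w hw v hvP
    -- `m = 1` or `m = 2`
    obtain rfl | rfl : m = 1 ∨ m = 2 := by omega
    · -- #### one factor: (T2a) with exponent `a 0`
      left
      have hQ0 : Q 0 ∈ Ideal.span (Set.range c2) := by rw [hc2P]; exact hQP 0
      obtain ⟨lam, hlam⟩ := Ideal.mem_span_range_iff_exists_fun.mp hQ0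
      obtain ⟨i₀, hi₀⟩ : ∃ i₀, lam i₀ ∉ (stalkIdeal (vanishingIdeal C₀) x₀) := by
        by_contra hall
        push Not at hall
        apply hQP2 0
        rw [← hlam, pow_two]
        exact Ideal.sum_mem _ fun i _ => Ideal.mul_mem_mul (hall i) (by rw [← hc2P]; exact Ideal.subset_span ⟨i, rfl⟩)
      obtain ⟨j, μ, π', ⟨i₁, hμ⟩, hπ', hnf⟩ := exists_simple_normalForm (stalkIdeal (vanishingIdeal C₀) x₀) w hw c2 lam hi₀
      obtain ⟨i₂, hi₂⟩ : ∃ i₂ : Fin 2, i₁ ≠ i₂ := ⟨i₁ + 1, by fin_cases i₁ <;> simp⟩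
      obtain ⟨X, hXi, hXn, σ, hσ, C, x, h, hσx, hxcl⟩ := exists_pointChainAlong_isDominant hX₀ hC₀reg hx₀ hx₀C hdim₀ (max j k)
      subst hσx
      refine ⟨X, hXi, hXn, σ, hσ, C, x, _, h, rfl, hxcl, ?_⟩
      have hXf : (∑ l : Fin p, (fun l => cc l * RatFn.toFunctionField (σ x) D) l ^ p * G ^ (l : ℕ)) = RatFn.toFunctionField (σ x)
          (1 * (∑ i, (w ^ j * μ i + π' i) * c2 i) ^ a 0 * ∏ i : Fin 1, ((fun _ => γ) i * w ^ (fun _ => k) i + (fun _ => π) i) ^ (fun _ : Fin 1 => 1) i) := by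
        rw [hX, Fin.prod_univ_one, hQdef]
        simp only
        rw [show s 0 ^ (p - 1) * q 0 = ∑ i, lam i * c2 i from hlam.symm, hnf, hvk]
        simp
        ring
      exact cleanPermissibleAt_of_pointChain_simpleContaining h hX₀ hC₀reg hx₀C hdim₀ p G _ hcc' w 1 hw isUnit_one c2 hc2 hc2P j μ π' hπ'
        hi₂ hμ (a 0) (ha 0) (le_max_left j k) (fun _ : Fin 1 => γ) (fun _ => π) (fun _ => hγ) (fun _ => hπ) (fun _ => k) (fun _ => 1)
        (fun _ => le_max_right j k) hXf
    · -- #### two factors: good pair exits, bad pair is the residual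
      by_cases hgood : Ideal.span (Set.range Q) = (stalkIdeal (vanishingIdeal C₀) x₀)
      · left
        have hQrsop : IsRsopPart Q := isRsopPart_of_span_eq_span hc2 hc2P hgood
        have hXg : (∑ l : Fin p, (fun l => cc l * RatFn.toFunctionField x₀ D) l ^ p * G ^ (l : ℕ)) = RatFn.toFunctionField x₀
            (1 * (∏ j, Q j ^ a j) * ∏ i : Fin 1, ((fun _ => γ) i * w ^ (fun _ => k) i + (fun _ => π) i) ^ (fun _ : Fin 1 => 1) i) := by
          rw [hX, hvk]; simp; ring
        obtain ⟨X, hXi, hXn, σ, hσ, C, x, h, hσx, hxcl, hperm⟩ :=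
          exists_pointChain_cleanPermissibleAt hX₀ hC₀reg hx₀ hx₀C hdim₀ p G _ hcc' w 1 hw isUnit_one Q hQrsop hgood a
            (fun _ : Fin 1 => γ) (fun _ => π) (fun _ => hγ) (fun _ => hπ) (fun _ => k) (fun _ => 1) (Or.inl ⟨0, ha 0⟩) hXg
        exact ⟨X, hXi, hXn, σ, hσ, C, x, _, h, hσx, hxcl, hperm⟩
      · right
        -- `(Q₀, Q₁) B = (stalkIdeal (vanishingIdeal C₀) x₀) B`: some `e ∉ (stalkIdeal (vanishingIdeal C₀) x₀)` multiplies `(stalkIdeal (vanishingIdeal C₀) x₀)` into `(Q₀, Q₁)`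
        have hspanQ : maximalIdeal B ≤ Ideal.map (algebraMap (X₀.presheaf.stalk x₀) B) (Ideal.span (Set.range Q)) := by
          rw [← hspan, Ideal.span_le]
          rintro _ ⟨i, rfl⟩
          have hi : Fin.castLE hmd i = i := Fin.ext rfl
          obtain ⟨sU, hsU⟩ := (hunitP (s i)).mpr (hs i)
          have h2 : t i = (↑sU⁻¹ : B) ^ p * (algebraMap (X₀.presheaf.stalk x₀) B) (Q i) := by
            rw [hQφ i, hi, ← mul_assoc, ← mul_pow, ← hsU, Units.inv_mul, one_pow, one_mul]
          rw [h2]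
          exact Ideal.mul_mem_left _ _ (Ideal.mem_map_of_mem _ (Ideal.subset_span ⟨i, rfl⟩))
        have hec : ∀ i : Fin 2, ∃ e : (X₀.presheaf.stalk x₀), e ∉ (stalkIdeal (vanishingIdeal C₀) x₀) ∧ e * c2 i ∈ Ideal.span (Set.range Q) := by
          intro i
          have h1 : (algebraMap (X₀.presheaf.stalk x₀) B) (c2 i) ∈ Ideal.map (algebraMap (X₀.presheaf.stalk x₀) B) (Ideal.span (Set.range Q)) :=
            hspanQ ((hmemP _).mpr (by rw [← hc2P]; exact Ideal.subset_span ⟨i, rfl⟩))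
          obtain ⟨⟨⟨y, hy⟩, e⟩, hye⟩ := (IsLocalization.mem_map_algebraMap_iff (stalkIdeal (vanishingIdeal C₀) x₀).primeCompl B).mp h1
          have h2 : (algebraMap (X₀.presheaf.stalk x₀) B) (c2 i * e) = (algebraMap (X₀.presheaf.stalk x₀) B) y := by rw [map_mul]; exact hye
          obtain ⟨c, hc⟩ := (IsLocalization.eq_iff_exists (stalkIdeal (vanishingIdeal C₀) x₀).primeCompl B).mp h2
          refine ⟨c * e, fun h => (hP.mem_or_mem h).elim c.2 e.2, ?_⟩
          have h4 : (c : (X₀.presheaf.stalk x₀)) * e * c2 i = c * (c2 i * e) := by ring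
          rw [h4, hc]
          exact Ideal.mul_mem_left _ _ hy
        choose e he heQ using hec
        refine ⟨_, v, Q, a, e 0 * e 1, hcc', hX, hvP, hQP, hQP2, ha, fun h => (hP.mem_or_mem h).elim (he 0) (he 1), ?_, hgood⟩
        rw [← hc2P, Ideal.span_mul_span', Ideal.span_le]
        rintro _ ⟨x, hx, y, ⟨i, rfl⟩, rfl⟩
        rw [Set.mem_singleton_iff.mp hx]
        fin_cases i
        · have h5 : e 0 * e 1 * c2 0 = e 1 * (e 0 * c2 0) := by ring
          simpa [h5] using Ideal.mul_mem_left _ (e 1) (heQ 0)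
        · have h5 : e 0 * e 1 * c2 1 = e 0 * (e 1 * c2 1) := by ring
          simpa [h5] using Ideal.mul_mem_left _ (e 0) (heQ 1)
  · -- ### type (2) at the generic point: (T1′)
    left
    obtain ⟨v₀, s, hs, hus⟩ := hsurj u
    have hv₀ : v₀ ∉ (stalkIdeal (vanishingIdeal C₀) x₀) := by
      intro h
      have h1 : (algebraMap (X₀.presheaf.stalk x₀) B) v₀ ∈ maximalIdeal B := (hmemP v₀).mpr h
      rw [← hus] at h1
      exact (maximalIdeal.isMaximal B).ne_top (Ideal.eq_top_of_isUnit_mem _ h1 (hu.mul ((hunitP s).mpr hs)))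
    set R : (X₀.presheaf.stalk x₀) := s ^ (p - 1) * v₀ with hRdef
    have hRφ : (algebraMap (X₀.presheaf.stalk x₀) B) R = (algebraMap (X₀.presheaf.stalk x₀) B) s ^ p * u := (hclear u v₀ s hus).symm
    have hRP : R ∉ (stalkIdeal (vanishingIdeal C₀) x₀) := fun h => (hP.mem_or_mem h).elim (fun h1 => hs (hP.mem_of_pow_mem _ h1)) hv₀
    obtain ⟨hcc', hX'⟩ := rep_scale_mul_pow p G cc hcc (RatFn.toFunctionField x₀ s) _ (hne0 s hs) hGX
    have hX : (∑ j : Fin p, (fun j => cc j * RatFn.toFunctionField x₀ s) j ^ p * G ^ (j : ℕ)) = RatFn.toFunctionField x₀ R := by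
      rw [hX', ← hf, ← hf, ← map_pow, ← map_mul, ← hRφ]
    have hRpow : ∀ c : (X₀.presheaf.stalk x₀), R - c ^ p ∉ (stalkIdeal (vanishingIdeal C₀) x₀) := by
      intro c hc
      have h1 : (algebraMap (X₀.presheaf.stalk x₀) B) (R - c ^ p) ∈ maximalIdeal B := (hmemP _).mpr hc
      rw [map_sub, map_pow, hRφ] at h1
      obtain ⟨sU, hsU⟩ := (hunitP s).mpr hs
      apply hup ((algebraMap (X₀.presheaf.stalk x₀) B) c * ↑sU⁻¹)
      have key : u - ((algebraMap (X₀.presheaf.stalk x₀) B) c * ↑sU⁻¹) ^ p = (↑sU⁻¹ : B) ^ p * ((algebraMap (X₀.presheaf.stalk x₀) B) s ^ p * u - (algebraMap (X₀.presheaf.stalk x₀) B) c ^ p) := by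
        have hu' : u = ((↑sU⁻¹ : B) * (algebraMap (X₀.presheaf.stalk x₀) B) s) ^ p * u := by rw [← hsU, Units.inv_mul, one_pow, one_mul]
        conv_lhs => rw [hu']
        ring
      rw [key]
      exact Ideal.mul_mem_left _ _ h1
    exact exists_pointChain_cleanPermissibleAt_of_rep_residue_not_pow hX₀ hE p hC₀reg hx₀ hx₀C hdim₀ w hw G _ hcc' R hX hRP hRpow
  · -- ### type (3) at the generic point: shift and (T2a′)
    left
    obtain ⟨a₁, d₁, hd₁, h₁⟩ := hsurj s'
    obtain ⟨a₂, d₂, hd₂, h₂⟩ := hsurj c'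
    set D : (X₀.presheaf.stalk x₀) := d₁ * d₂ with hDdef
    have hDP : D ∉ (stalkIdeal (vanishingIdeal C₀) x₀) := fun h => (hP.mem_or_mem h).elim hd₁ hd₂
    set R : (X₀.presheaf.stalk x₀) := d₁ ^ (p - 1) * a₁ * d₂ ^ p with hRdef
    set b : (X₀.presheaf.stalk x₀) := d₁ * a₂ with hbdef
    have hRφ : (algebraMap (X₀.presheaf.stalk x₀) B) R = (algebraMap (X₀.presheaf.stalk x₀) B) D ^ p * s' := by
      rw [hRdef, map_mul, ← hclear s' a₁ d₁ h₁, hDdef, map_mul, map_pow]; ring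
    have hbφ : (algebraMap (X₀.presheaf.stalk x₀) B) b = (algebraMap (X₀.presheaf.stalk x₀) B) D * c' := by
      rw [hbdef, map_mul, ← h₂, hDdef, map_mul]; ring
    have hRbφ : (algebraMap (X₀.presheaf.stalk x₀) B) (R - b ^ p) = (algebraMap (X₀.presheaf.stalk x₀) B) D ^ p * (s' - c' ^ p) := by
      rw [map_sub, map_pow, hRφ, hbφ]; ring
    obtain ⟨hcc', hX'⟩ := rep_scale_mul_pow p G cc hcc (RatFn.toFunctionField x₀ D) _ (hne0 D hDP) hGX
    have hX : (∑ j : Fin p, (fun j => cc j * RatFn.toFunctionField x₀ D) j ^ p * G ^ (j : ℕ)) = RatFn.toFunctionField x₀ R := by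
      rw [hX', ← hf, ← hf, ← map_pow, ← map_mul, ← hRφ]
    have hRbP : R - b ^ p ∈ (stalkIdeal (vanishingIdeal C₀) x₀) := by
      rw [← hmemP, hRbφ]; exact Ideal.mul_mem_left _ _ hsc
    have hRbP2 : R - b ^ p ∉ (stalkIdeal (vanishingIdeal C₀) x₀) ^ 2 := by
      intro h
      have h1 : (algebraMap (X₀.presheaf.stalk x₀) B) (R - b ^ p) ∈ maximalIdeal B ^ 2 := by
        rw [← hmapP, ← Ideal.map_pow]; exact Ideal.mem_map_of_mem _ h
      rw [hRbφ] at h1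
      obtain ⟨dU, hdU⟩ := (hunitP D).mpr hDP
      apply hsc2
      have h2 : s' - c' ^ p = (↑dU⁻¹ : B) ^ p * ((algebraMap (X₀.presheaf.stalk x₀) B) D ^ p * (s' - c' ^ p)) := by
        rw [← mul_assoc, ← mul_pow, ← hdU, Units.inv_mul, one_pow, one_mul]
      rw [h2]
      exact Ideal.mul_mem_left _ _ h1
    obtain ⟨cc'', hcc'', hX''⟩ := rep_shift_sub_pow p (RatFn.toFunctionField x₀) G _ hcc' R b hX
    exact exists_pointChain_cleanPermissibleAt_of_rep_mem_not_mem_sq hX₀ p hC₀reg hx₀ hx₀C hdim₀ w hw G cc'' hcc'' (R - b ^ p) hX'' hRbP hRbP2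

end Summit.ResolutionOfSingularities.ResolutionOfSingularities.Theorems.RadicialJung.CleanModels

end
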